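import Mathlib
import Summits.Ventures.HodgeRepro2.Defs

/-!
# T6Interface — the Tier-6 interface for the bridge A1–A3 (README §10; route/TARGET-T6.md §2 Layer I, v0)

Sole filer: t6-lead (planner-pub-hodge-repro2-t6-lead-g0-0). Statement lane: definitions and structures only,
no theorem, no axiom, no `sorry`.

THE MODEL. For the corner product `B = A_1 × A_2 × A_3 × A_4` of CM abelian threefolds of types `T i` over the
CM field `K` (TIER4 A0.1–A0.3), `H¹(B, ℚ)` is a free `K`-module with one copy of `K` per vertex (p1's `cornerH1`,
`Fin 4 → K`), and `H^*(B, ℚ) = ⋀ H¹(B, ℚ)` (Lange Cor. 1.1.19 / Prop. 1.1.20, TIER4 A1 EXTERNAL FACTS; cup = wedge).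
So the cohomology ring of `B` is the EXPLICIT exterior algebra `HB K := ExteriorAlgebra ℚ (Fin 4 → K)` and its
complex form is `HBC K := ExteriorAlgebra ℂ (Fin 4 → ℂ ⊗[ℚ] K)`; the eigenlines `ℓ_{i,σ}` and the Hodge
bigrading are DEFINED from the CM types (TIER4 A0.4–A0.6, Lemma A0.5). What the kernel cannot compute is carried
as DATA with its characterising Prop fields in `TransferShadow`: the algebraic-class subspaces `Alg`, the
orientation `intB = ∫_B`, the Pontryagin product `pont = m_* ∘ ×` (characterised against `cop = m^*`), and the
cohomological SHADOW of the surface `S` with `f : S → B` — the ℂ-algebra `HS = H^*(S, ℂ)`, `pull = f^*`,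
`intS = ∫_S`, and the Gysin class `z = f_*(1_S)` with the projection formula. Every Prop field is a printed
textbook fact (TIER4 A2 EXTERNAL FACTS E1–E41; A1's Fulton / Bredon / Lange rows) specialised to this diagram;
none is an axiom of the tree — Layer III (T6Dict.lean) discharges them from the displayed hypotheses on the
host carriers (TARGET-T6.md §2, §6 R2).

The two closing Props: `WeilClassesAlgebraic` (= the conclusion of Theorem A, TIER4 A3 Theorem A(ii)) and
`PeriodInputN` (= the period input (N), ibid.; its Tier-5 form (N_D) is TIER5 (N0.3)).
-/

open scoped TensorProduct

namespace Summit.Ventures.HodgeRepro2.T6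

noncomputable section

variable (K : Type*) [Field K] [NumberField K]

/-! ## 1. The carriers of the corner product `B` (explicit) -/

/-- `K ⊗ ℂ`, the coefficient algebra of one vertex after complexification (`H¹(A_i, ℂ) = H¹(A_i, ℚ) ⊗ ℂ`). -/
abbrev KC := ℂ ⊗[ℚ] K

/-- `H¹(B, ℚ)`: one copy of `K` per vertex (p1 `cornerH1 K`). -/
abbrev H1 := Fin 4 → K

/-- `H¹(B, ℂ)`: one copy of `K ⊗ ℂ` per vertex. -/
abbrev H1C := Fin 4 → KC K

/-- `H^*(B, ℚ) = ⋀ H¹(B, ℚ)` (Lange Cor. 1.1.19 / Prop. 1.1.20; cup product = wedge). -/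
abbrev HB := ExteriorAlgebra ℚ (H1 K)

/-- `H^*(B, ℂ) = ⋀_ℂ H¹(B, ℂ)`. -/
abbrev HBC := ExteriorAlgebra ℂ (H1C K)

/-- The complexification of `H¹`: `v ↦ (i ↦ 1 ⊗ v i)`, a ℚ-linear map `H¹(B, ℚ) → H¹(B, ℂ)`. -/
def h1ToC : H1 K →ₗ[ℚ] H1C K :=
  LinearMap.pi fun i => (Algebra.TensorProduct.includeRight : K →ₐ[ℚ] KC K).toLinearMap ∘ₗ LinearMap.proj i

/-- The complexification `H^*(B, ℚ) → H^*(B, ℂ)` as a ℚ-algebra map (`a ↦ a ⊗ 1`). -/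
def extC : HB K →ₐ[ℚ] HBC K :=
  ExteriorAlgebra.lift ℚ ⟨(ExteriorAlgebra.ι ℂ).restrictScalars ℚ ∘ₗ h1ToC K, fun m => by simp⟩

/-- The `K`-action on `H¹(B, ℚ)` by the diagonal CM structure: `x • v = (i ↦ x * v i)`
(the pull-back `[x]^*` of TIER4 A0.3 on `H¹`, extended ℚ-linearly from the order `O'` to `K`). -/
def actH1 (x : K) : H1 K →ₗ[ℚ] H1 K :=
  LinearMap.pi fun i => (LinearMap.mul ℚ K x) ∘ₗ LinearMap.proj i

/-- The same action on `H^*(B, ℚ)`, as the algebra endomorphism induced by `actH1 x`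
(`[x]^*` on all of `H^*(B, ℚ)`; a ring homomorphism, TIER4 A0.3(ii)). -/
def pullEndo (x : K) : HB K →ₐ[ℚ] HB K :=
  ExteriorAlgebra.lift ℚ ⟨ExteriorAlgebra.ι ℚ ∘ₗ actH1 K x, fun m => by simp⟩

/-- The degree-`k` part `H^k(B, ℚ) = ⋀^k H¹(B, ℚ)`. -/
abbrev degB (k : ℕ) : Submodule ℚ (HB K) := ⋀[ℚ]^k (H1 K)

/-- The degree-`k` part `H^k(B, ℂ) = ⋀^k H¹(B, ℂ)`. -/
abbrev degBC (k : ℕ) : Submodule ℂ (HBC K) := ⋀[ℂ]^k (H1C K)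

/-! ## 2. Eigenlines and the Hodge bigrading (TIER4 A0.4–A0.6, Lemma A0.5) -/

/-- The `σ`-eigenline of `K ⊗ ℂ` for an embedding `σ : K →+* ℂ`:
`{v | ∀ x : K, (1 ⊗ x) * v = σ x • v}` (a ℂ-line; `K ⊗ ℂ ≅ ∏_σ ℂ`). -/
def eigenLineK (σ : K →+* ℂ) : Submodule ℂ (KC K) where
  carrier := {v | ∀ x : K, (Algebra.TensorProduct.includeRight x : KC K) * v = σ x • v}
  add_mem' := by
    intro a b ha hb x
    rw [mul_add, ha x, hb x, smul_add]
  zero_mem' := by intro x; simp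
  smul_mem' := by
    intro c v hv x
    rw [Algebra.mul_smul_comm, hv x, smul_comm]

/-- The eigenline `ℓ_{i,σ} ⊂ H¹(B, ℂ)`: the `σ`-eigenline of the `i`-th vertex
(`ℓ_{i,σ} = {v : ι_i(x)^* v = σ(x) v}`, TIER4 A1 Theorem A1(i)). -/
def eigenLine (i : Fin 4) (σ : K →+* ℂ) : Submodule ℂ (H1C K) :=
  (eigenLineK K σ).map (LinearMap.single ℂ (fun _ => KC K) i)

/-- The face datum: `K` sextic, four CM types `T i ⊂ Hom(K, ℂ)` forming a rank-four (balanced) face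
(p1 `IsWeilFace`: every embedding lies in exactly two of the `T i`; Deligne 1982 Prop. 4.4 / Milne 2020 Plain 2.2
with `Σ_i φ_i(s) = 2`). -/
structure FaceSetting where
  /-- `K` is sextic (TIER4 A0.1: `F` a Galois CM field of degree 6; the threefolds `A_i`, `dim B = 12`) -/
  deg6 : Module.finrank ℚ K = 6
  /-- the four CM types (the vertices of the face) -/
  T : Fin 4 → Set (K →+* ℂ)
  /-- the face is balanced -/
  face : Summit.Ventures.HodgeRepro2.IsWeilFace K T

variable {K}

/-- `H^{1,0}(B) = ⊕_i ⊕_{σ ∈ T i} ℓ_{i,σ}` (Lemma A0.5: `ℓ_{i,σ} ⊂ H^{1,0}(A_i)` iff `σ ∈ T i`). -/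
def h10 (F : FaceSetting K) : Submodule ℂ (H1C K) :=
  ⨆ i : Fin 4, ⨆ σ ∈ F.T i, eigenLine K i σ

/-- `H^{0,1}(B) = ⊕_i ⊕_{σ ∉ T i} ℓ_{i,σ}`. -/
def h01 (F : FaceSetting K) : Submodule ℂ (H1C K) :=
  ⨆ i : Fin 4, ⨆ σ ∈ (F.T i)ᶜ, eigenLine K i σ

/-- A ℂ-subspace of `H¹(B, ℂ)` viewed inside `H^*(B, ℂ)` through `ι`. -/
def ιW (W : Submodule ℂ (H1C K)) : Submodule ℂ (HBC K) := W.map (ExteriorAlgebra.ι ℂ)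

/-- The Hodge piece `H^{p,q}(B) = ⋀^p H^{1,0} ∧ ⋀^q H^{0,1}` (TIER4 A0.6; Lange Thm. 1.1.21:
`H^q(Ω^p) ≅ ⋀^p Ω ⊗ ⋀^q Ω̄`), as the product of submodules in the exterior algebra. -/
def hodge (F : FaceSetting K) (p q : ℕ) : Submodule ℂ (HBC K) :=
  (ιW (h10 F)) ^ p * (ιW (h01 F)) ^ q

/-- The complex split Weil space `W_ℂ = ⊕_σ ⋀^4 V_σ = ⊕_σ ℂ·w_σ`,
`w_σ = e_{1,σ} ∧ e_{2,σ} ∧ e_{3,σ} ∧ e_{4,σ}` (TIER4 Def. A1.1). -/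
def weilC (_F : FaceSetting K) : Submodule ℂ (HBC K) :=
  ⨆ σ : K →+* ℂ, ιW (eigenLine K 0 σ) * ιW (eigenLine K 1 σ) * ιW (eigenLine K 2 σ) * ιW (eigenLine K 3 σ)

/-- The rational split Weil line `W_K(B) = ⋀^4_K H¹(B, ℚ) ⊂ H^4(B, ℚ)` (p1 `cornerWeilLine`, Deligne 1982
Lemma 4.3(b) / 4.4; TIER4 Lemma A1.3), viewed inside `H^*(B, ℚ)`. -/
def weilQ (K : Type*) [Field K] [NumberField K] : Submodule ℚ (HB K) :=
  (Summit.Ventures.HodgeRepro2.cornerWeilLine K).map (⋀[ℚ]^4 (H1 K)).subtype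

/-! ## 3. The graded tensor product `H^*(B × B, ℚ)` and the coproduct `m^*` (TIER4 (A5.0)–(A5.1)) -/

variable (K)

/-- The grading of `H^*(B, ℚ)` by degree, `H^k = ⋀^k H¹` (Mathlib `ExteriorAlgebra.gradedAlgebra`). -/
instance instGradedHB : GradedAlgebra (fun i : ℕ => ⋀[ℚ]^i (H1 K)) := ExteriorAlgebra.gradedAlgebra ℚ (H1 K)

/-- `H^*(B × B, ℚ) = H^*(B, ℚ) ᵍ⊗ H^*(B, ℚ)` (Künneth with the Koszul sign rule; Bredon Thm. VI.3.2, E11). -/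
abbrev HBB := GradedTensorProduct ℚ (fun i : ℕ => ⋀[ℚ]^i (H1 K)) (fun i : ℕ => ⋀[ℚ]^i (H1 K))

/-- `pr_1^*` : `H^*(B) → H^*(B × B)`. -/
def inl : HB K →ₐ[ℚ] HBB K := GradedTensorProduct.includeLeft _ _
/-- `pr_2^*` : `H^*(B) → H^*(B × B)`. -/
def inr : HB K →ₐ[ℚ] HBB K := GradedTensorProduct.includeRight _ _

/-! ## 4. The transfer shadow: what the bridge needs from `Alg`, `∫_B`, `m_*`, `S` and `f` -/

variable {K}

/-- The data the bridge A1–A3 consumes beyond the explicit model (TARGET-T6.md §2 Layer I). Every Prop field is a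
printed fact of TIER4 A1/A2 EXTERNAL FACTS specialised to this diagram; Layer III supplies an instance from the
displayed hypotheses on the host carriers. -/
structure TransferShadow (F : FaceSetting K) where
  /-- `Alg k ⊂ H^{2k}(B, ℚ)`: the ℚ-span of the classes of codimension-`k` subvarieties (Fulton Ch. 19, `cl`). -/
  Alg : ℕ → Submodule ℚ (HB K)
  /-- algebraic classes have the right degree -/
  alg_deg : ∀ k, Alg k ≤ degB K (2 * k)
  /-- the fundamental class: `1 = cl(B) ∈ Alg 0` -/
  alg_one : (1 : HB K) ∈ Alg 0
  /-- `cl` is a ring homomorphism: `Alg` is closed under cup product (Fulton Cor. 19.2(b), E8) -/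
  alg_mul : ∀ {k l : ℕ} {a b : HB K}, a ∈ Alg k → b ∈ Alg l → a * b ∈ Alg (k + l)
  /-- `cl` is contravariant: `[x]^*` preserves algebraic classes (Fulton Cor. 19.2(b); TIER4 A2.4 / A3.1) -/
  alg_pull : ∀ (x : K) {k : ℕ} {a : HB K}, a ∈ Alg k → pullEndo K x a ∈ Alg k
  /-- Lefschetz (1,1) on `B` (Lange Prop. 1.2.9; Voisin I Thm. 7.2; TIER4 A2 (S2), E22/E31):
  a rational class of degree 2 and Hodge type (1,1) is algebraic. -/
  alg_lefschetz : ∀ a ∈ degB K 2, extC K a ∈ hodge F 1 1 → a ∈ Alg 1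
  /-- `∫_B : H^*(B, ℚ) → ℚ`, the orientation / degree map (Bredon VI.8.3; TIER4 B4 sign conventions). -/
  intB : HB K →ₗ[ℚ] ℚ
  /-- `∫_B` kills every degree but the top one (`2 dim B = 24`) -/
  intB_deg : ∀ k ≠ 24, ∀ a ∈ degB K k, intB a = 0
  /-- `∫_B` is non-zero in the top degree -/
  intB_ne_zero : ∃ a ∈ degB K 24, intB a ≠ 0
  /-- `∫_{B×B} (a ⊗ b) = ∫_B a · ∫_B b` (Bredon Thm. VI.5.4 / product orientation, E12/E15; TIER4 (A5.2.0)). -/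
  intBB : HBB K →ₗ[ℚ] ℚ
  intBB_tmul : ∀ a b : HB K, intBB (inl K a * inr K b) = intB a * intB b
  /-- `m^* : H^*(B) → H^*(B × B)`, the pull-back along the addition `m : B × B → B`;
  on `H¹` it is `φ ↦ φ ⊗ 1 + 1 ⊗ φ` (Hatcher §3.C, Lange §1.1; TIER4 (A5.1.1)). -/
  cop : HB K →ₐ[ℚ] HBB K
  cop_ι : ∀ v : H1 K, cop (ExteriorAlgebra.ι ℚ v) = inl K (ExteriorAlgebra.ι ℚ v) + inr K (ExteriorAlgebra.ι ℚ v)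
  /-- the Pontryagin product `a ⋆ b = m_*(pr_1^* a ∪ pr_2^* b)` (Lange §2.5.3, E41), characterised by
  Poincaré duality and the projection formula: `∫_B (a ⋆ b) ∪ u = ∫_{B×B} (a ⊗ b) ∪ m^* u` (Bredon VI.5.3 / VI.8.3). -/
  pont : HB K →ₗ[ℚ] HB K →ₗ[ℚ] HB K
  pont_spec : ∀ a b u : HB K, intB (pont a b * u) = intBB (inl K a * inr K b * cop u)
  /-- the Pontryagin product of algebraic classes is algebraic: proper push-forward `m_*` and exterior products
  of cycle classes (Fulton p0356 l. 19 (E3), Ex. 19.1.9 (E6); TIER4 A2 (S3)); `dim B = 12`. -/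
  alg_pont : ∀ {k l : ℕ} {a b : HB K}, a ∈ Alg k → b ∈ Alg l → pont a b ∈ Alg (k + l - 12)
  /-- THE SURFACE SHADOW: `H^*(S, ℂ)` of the compact Picard modular surface `S` (Liu 2021 Prop. C.5, TIER4 A1(v)). -/
  HS : Type
  [instRingHS : Ring HS]
  [instAlgHS : Algebra ℂ HS]
  /-- `f^* : H^*(B, ℂ) → H^*(S, ℂ)`, the pull-back along `f = (f_1, …, f_4) : S → B` (a ring homomorphism). -/
  pull : HBC K →ₐ[ℂ] HS
  /-- `∫_S : H^*(S, ℂ) → ℂ`. -/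
  intS : HS →ₗ[ℂ] ℂ
  /-- the Gysin class `z = f_*(1_S) ∈ H^{20}(B, ℚ)` (TIER4 A2 (S1)) -/
  z : HB K
  z_deg : z ∈ degB K 20
  /-- `z` is algebraic: `cl` commutes with proper push-forward (Fulton Lemma 19.1.2 / p0356 l. 19, Prop. 1.4; E3/E9) -/
  z_alg : z ∈ Alg 10
  /-- the projection formula `∫_B z ∪ u = ∫_S f^* u` for every `u ∈ H^*(B, ℚ)` (Bredon Cor. VI.5.3, E14;
  TIER4 Lemma A4.1.1 / (S1)) — stated over ℚ, extended to ℂ by linearity in `PeriodInputN` below -/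
  z_proj : ∀ u : HB K, ((intB (z * u) : ℚ) : ℂ) = intS (pull (extC K u))

attribute [instance] TransferShadow.instRingHS TransferShadow.instAlgHS

/-! ## 5. The two closing Props -/

/-- THE CONCLUSION OF THEOREM A (TIER4 A3 Theorem A(ii), second clause): every element of the rational split
Weil line `W_K(B)` is an algebraic class. -/
def WeilClassesAlgebraic {F : FaceSetting K} (D : TransferShadow F) : Prop :=
  ∀ w ∈ weilQ K, w ∈ D.Alg 2

/-- THE PERIOD INPUT (N) (TIER4 A3 Theorem A(ii)): for at least one embedding `σ`,
`∫_S f_1^* e_{1,σ} ∧ f_2^* e_{2,σ} ∧ f_3^* e_{3,σ} ∧ f_4^* e_{4,σ} ≠ 0`, i.e. `∫_S f^* w ≠ 0` for some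
`w ∈ ℂ·w_σ` — stated on the complex Weil space `W_ℂ` (the statement is linear in the generators, TIER4 A3
Theorem A(iii)). Tier-5 form (N_D): TIER5 (N0.3). -/
def PeriodInputN {F : FaceSetting K} (D : TransferShadow F) : Prop :=
  ∃ w ∈ weilC F, D.intS (D.pull w) ≠ 0

end

end Summit.Ventures.HodgeRepro2.T6
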